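import Summits.BirchSwinnertonDyer.BirchSwinnertonDyer.Theses.UniversalToricDescent
import Summits.BirchSwinnertonDyer.BirchSwinnertonDyer.Theorems.ThetaPartnerAtTwoSignedControlAtTwoShaTwoOfBridgeOfLocalGlobal
import Summits.BirchSwinnertonDyer.BirchSwinnertonDyer.Theorems.SchneiderFreeAdditiveX3PoitouTateShaTwoLocalGlobalReal
import Summits.BirchSwinnertonDyer.BirchSwinnertonDyer.Theorems.SchneiderFreeAdditiveX3PoitouTateReciprocityEqualityHolds
import HarnessLib

/-!
# Leaf PT2 `PoitouTateShaTateDualFact` (stmt-BirchSwinnertonDyer-20462) of route `UniversalToricDescent` — PROVED BY NAME: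
# `poitouTate_sha_tateDual K` (Milne *ADT* I Thm. 4.10 (a)) for EVERY number field `K`

Seat `bsd-line-chl-p2` g7 (cell `bsd-wall`; the PT2 side of K4 `RedSplitControlAtThree`).  Composition of three cells' theorems:
* `PoitouTateShaTwoReadout.poitouTate_sha_tateDual_of_bridge_of_localGlobal'` (seat bsd-inputs-k4-p1, cell bsd-wall TP2: PT2 for
  any `K` from the bridge (nat, R4=) and the degree-2 local–global input (A); `SelmerComplement`, Tate duality for `C̄`, THE idèle
  projections, (R3), (B) inside);
* (nat, R4=) := `PoitouTateReduction.hR4_ideleProjection` (cell bsd-schneider door-c5 g18);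
* (A) := `PoitouTateShaTwoReadout.tateDual_localGlobal_real` (cell bsd-schneider door-c4 g19 — the real-place port of this seat's
  `tateDual_localGlobal`: Brauer–Hasse–Noether over `K(M)`, inf–res + Hilbert 90, local triviality ascends, transport along
  `Gal(K̄/K(M)) ≃ Γ_{K(M)}` up to one inner automorphism).

* **`poitouTate_sha_tateDual_numberField (K)`** — `poitouTate_sha_tateDual K` for every number field `K`;
* **`poitouTateShaTateDualFact_proof`** — TYPE = the route decl
  `Summit.BirchSwinnertonDyer.BirchSwinnertonDyer.Theses.UniversalToricDescent.PoitouTateShaTateDualFact` verbatim.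

HONEST FRAMING: this is Milne I 4.10 (a) (`Ш¹(K, M)` finite and `#Ш¹(K, M) = #Ш²(K, M^D)` in the tree's currency) assembled from
the three cells' class-field-theoretic packages; BSD is NOT proved here; standard axioms only.

References: [MilneADT2006] I Thm. 4.10 (a) and its proof (p. 58), Lemma 4.13; [CasselsFrohlichANT1967] Ch. VII §11.2 (bis);
[Harari2020] Thm. 17.13.
-/

noncomputable section

open Function NumberField IsDedekindDomain CategoryTheory CategoryTheory.Abelian Field
open scoped NumberField ContRepresentation

-- `Summit.<P>.<Sub>` repeats `BirchSwinnertonDyer` by the tree's layout convention (D-0017)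
set_option linter.dupNamespace false

namespace Summit.BirchSwinnertonDyer.BirchSwinnertonDyer.Theorems.PoitouTateShaTwoReadout

open Literature.NumberTheory.GaloisRepresentations Literature.NumberTheory.GaloisCohomology
open Summit.BirchSwinnertonDyer.BirchSwinnertonDyer.Theorems.SchneiderFreeAdditiveX3.PoitouTateReduction (hR4_ideleProjection)

/-- **`poitouTate_sha_tateDual K` (Milne I Thm. 4.10 (a)) for EVERY number field `K`.**
[cite: MilneADT2006, Ch. I, Thm. 4.10 (a) (proof, p. 58), Lemma 4.13][cite: CasselsFrohlichANT1967, Ch. VII §11.2 (bis)] -/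
theorem poitouTate_sha_tateDual_numberField (K : Type) [Field K] [NumberField K] : poitouTate_sha_tateDual K :=
  poitouTate_sha_tateDual_of_bridge_of_localGlobal' (fun n _ _ _ _ _ _ _ ρ₀ hM => hR4_ideleProjection n ρ₀ hM)
    fun n _ _ _ _ _ _ ρ₀ hM => tateDual_localGlobal_real ρ₀ n hM

end Summit.BirchSwinnertonDyer.BirchSwinnertonDyer.Theorems.PoitouTateShaTwoReadout

namespace Summit.BirchSwinnertonDyer.BirchSwinnertonDyer.Theorems

/-- **Leaf PT2 `PoitouTateShaTateDualFact` of route `UniversalToricDescent`, BY NAME** (also conjunct (ii) of K1's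
`ControlFacts` and stub `stub_poitouTateShaTateDual` of K4's line `birth`). [cite: MilneADT2006, Ch. I, Thm. 4.10 (a)]
[cite: Harari2020, Thm. 17.13] -/
theorem poitouTateShaTateDualFact_proof :
    Summit.BirchSwinnertonDyer.BirchSwinnertonDyer.Theses.UniversalToricDescent.PoitouTateShaTateDualFact :=
  fun K _ _ => PoitouTateShaTwoReadout.poitouTate_sha_tateDual_numberField K

end Summit.BirchSwinnertonDyer.BirchSwinnertonDyer.Theorems

end
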